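import Summits.CriticalPhenomena.PercolationContinuityZ3.Theses.PercNearOneGluing
import Literature.Probability.Percolation.PercolationProofs
import Literature.Probability.Percolation.ConditionalPositiveAssociationProofs
import Literature.Probability.Percolation.TwoClusterConditionalAssociationProofs
import Summits.CriticalPhenomena.PercolationContinuityZ3.Theorems.PercNearOneGluingAdditiveGluingGoodBase
import Summits.CriticalPhenomena.PercolationContinuityZ3.Theorems.PercNearOneGluingAdditiveGluingGoodTwoRelays
import Summits.CriticalPhenomena.PercolationContinuityZ3.Theorems.PercNearOneGluingAdditiveGluingLemma5AnyRelay
import Summits.CriticalPhenomena.PercolationContinuityZ3.Theorems.PercNearOneGluingAdditiveGluingGoodStep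
import Literature.Probability.LatticeModels.ProdBernoulliAtomExpansion
import Literature.Probability.Percolation.OpenGraphCuts

/-! TTRL-lite variant V978 of stmt-CriticalPhenomena-4576

**Verdict: DISPROVED.**  The variant (move `specialise`, `fix n := 5`, of the crux
`PercNearOneGluing.AdditiveGluing`) asks, for every weight `w` on `Sym2 (Fin 5)`, distinct relays
`a₁ a₂ a₃`, target `b ∉ {aᵢ}`, observer `o` and `t ∈ (0,1)` with `μ(aᵢ ↔ b) = 1 − t` and positive
pattern gaps `m₃ − m₁₂, m₁ − m₂₃, m₂ − m₁₃ > 0` (`μ = prodBernoulli w`, `m_T = μ(𝒞(b) ∩ A = T)`),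
that
`P₁P₂A₁₂(m₃ − m₁₂) − P₁₂P₂A₁(m₁ − m₂₃) − P₁₂P₁A₂(m₂ − m₁₃) ≤ P₁₂P₁P₂ · μ(o↮a₁, o↮a₂, o↮a₃, a₃↮b)`
(notation of `…KnBadBound`: `P₁₂ = μ(a₃ ↮ a₁,a₂)`, `A₁₂ = μ(a₃ ↮ a₁,a₂; o↔a₁ ∨ o↔a₂)`, …).
The `τ`-equalities force the three gaps to coincide (`= δ`), so the claim reads
`δ · (Kozma–Nitzan Lemma-2 gap) ≤ P₁P₂P₁₂ · μ(o ↮ A, a₃ ↮ b)`; it degenerates to `0 ≤ 0` on the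
faces `w(oaᵢ) = 1` and FAILS just inside them.

Counterexample (charged tree `a₁ — o — a₃`, `o — b — a₂`; `o=0, b=1, a₁=2, a₂=3, a₃=4`):
`w(oa₁) = w(oa₃) = 255/256`, `w(ob) = 1/3`, `w(ba₂) = 85/256`, all other weights `0`,
`t = 171/256`.  Then `τᵢ = 85/256`, the three gaps equal `7310/2²⁴ > 0`, and
`LHS = 48885269693433977375/2⁹⁵ ≈ 1.234·10⁻⁹ > RHS = 51886376860657385631/2⁹⁶ ≈ 6.549·10⁻¹⁰`.

Method: (1) `Literature.Probability.LatticeModels.prodBernoulli_real_eq_sum_prop₄`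
(`ProdBernoulliAtomExpansion.lean`) — almost-sure restriction to the four charged coordinates and
the atom expansion of `(prodBernoulli w).real S` as an explicit `16`-term sum for any event read
off from the four coordinates; (2) the connectivity table of the tree (`var978_r02 … var978_r34`,
via the closed-cut lemmas of `Literature.Probability.Percolation.OpenGraphCuts`); (3) the sixteen
probabilities of the statement are then evaluated by `norm_num`.
-/

namespace Summit.CriticalPhenomena.PercolationContinuityZ3.Theorems

open MeasureTheory Literature.Probability.LatticeModels Literature.Probability.Percolation
open scoped Classical BigOperators

/-! ### Connectivity table of the charged tree `a₁ — o — a₃`, `o — b — a₂` -/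

/-- `a₁ = 2` is isolated when its four edges are closed. [folklore] -/
theorem var978_iso2 (ω : BondConfig (Fin 5)) (h02 : s(0, 2) ∉ ω) (h12 : s(1, 2) ∉ ω)
    (h23 : s(2, 3) ∉ ω) (h24 : s(2, 4) ∉ ω) {y : Fin 5} (hy : y ≠ 2) :
    ¬ (openGraph ω).Reachable 2 y := by
  have hall : ∀ v : Fin 5, v ≠ 2 →
      s(2, v) = s(0, 2) ∨ s(2, v) = s(1, 2) ∨ s(2, v) = s(2, 3) ∨ s(2, v) = s(2, 4) := by decide
  refine not_reachable_openGraph_of_forall_notMem ω hy fun v hv => ?_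
  rcases hall v hv with e | e | e | e <;> rw [e] <;> assumption

/-- `a₂ = 3` is isolated when its four edges are closed. [folklore] -/
theorem var978_iso3 (ω : BondConfig (Fin 5)) (h03 : s(0, 3) ∉ ω) (h13 : s(1, 3) ∉ ω)
    (h23 : s(2, 3) ∉ ω) (h34 : s(3, 4) ∉ ω) {y : Fin 5} (hy : y ≠ 3) :
    ¬ (openGraph ω).Reachable 3 y := by
  have hall : ∀ v : Fin 5, v ≠ 3 →
      s(3, v) = s(0, 3) ∨ s(3, v) = s(1, 3) ∨ s(3, v) = s(2, 3) ∨ s(3, v) = s(3, 4) := by decide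
  refine not_reachable_openGraph_of_forall_notMem ω hy fun v hv => ?_
  rcases hall v hv with e | e | e | e <;> rw [e] <;> assumption

/-- `a₃ = 4` is isolated when its four edges are closed. [folklore] -/
theorem var978_iso4 (ω : BondConfig (Fin 5)) (h04 : s(0, 4) ∉ ω) (h14 : s(1, 4) ∉ ω)
    (h24 : s(2, 4) ∉ ω) (h34 : s(3, 4) ∉ ω) {y : Fin 5} (hy : y ≠ 4) :
    ¬ (openGraph ω).Reachable 4 y := by
  have hall : ∀ v : Fin 5, v ≠ 4 →
      s(4, v) = s(0, 4) ∨ s(4, v) = s(1, 4) ∨ s(4, v) = s(2, 4) ∨ s(4, v) = s(3, 4) := by decide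
  refine not_reachable_openGraph_of_forall_notMem ω hy fun v hv => ?_
  rcases hall v hv with e | e | e | e <;> rw [e] <;> assumption

/-- The cut `{o, a₁, a₃} = {0, 2, 4}` versus `{b, a₂} = {1, 3}` when `s(0,1)` is closed. [folklore] -/
theorem var978_cut024 (ω : BondConfig (Fin 5)) (h01 : s(0, 1) ∉ ω) (h03 : s(0, 3) ∉ ω)
    (h12 : s(1, 2) ∉ ω) (h23 : s(2, 3) ∉ ω) (h14 : s(1, 4) ∉ ω) (h34 : s(3, 4) ∉ ω)
    {x y : Fin 5} (hx : x = 0 ∨ x = 2 ∨ x = 4) (hy : y = 1 ∨ y = 3) :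
    ¬ (openGraph ω).Reachable x y := by
  have hall : ∀ u v : Fin 5, (u = 0 ∨ u = 2 ∨ u = 4) → ¬ (v = 0 ∨ v = 2 ∨ v = 4) →
      s(u, v) = s(0, 1) ∨ s(u, v) = s(0, 3) ∨ s(u, v) = s(1, 2) ∨ s(u, v) = s(2, 3) ∨
        s(u, v) = s(1, 4) ∨ s(u, v) = s(3, 4) := by decide
  have hy' : ¬ (y = 0 ∨ y = 2 ∨ y = 4) := by rcases hy with rfl | rfl <;> decide
  refine not_reachable_openGraph_of_closed_cut ω {v | v = 0 ∨ v = 2 ∨ v = 4} hx hy' ?_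
  intro u hu v hv
  rcases hall u v hu hv with e | e | e | e | e | e <;> rw [e] <;> assumption

/-- `o ↔ a₁` iff the edge `oa₁` is open. [folklore] -/
theorem var978_r02 (ω : BondConfig (Fin 5)) (h12 : s(1, 2) ∉ ω) (h23 : s(2, 3) ∉ ω)
    (h24 : s(2, 4) ∉ ω) : (openGraph ω).Reachable 0 2 ↔ s(0, 2) ∈ ω := by
  refine ⟨fun h => ?_, fun h => reachable_openGraph_of_mem ω h (by decide)⟩
  by_contra h02
  exact var978_iso2 ω h02 h12 h23 h24 (y := 0) (by decide) h.symm

/-- `o ↔ a₃` iff the edge `oa₃` is open. [folklore] -/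
theorem var978_r04 (ω : BondConfig (Fin 5)) (h14 : s(1, 4) ∉ ω) (h24 : s(2, 4) ∉ ω)
    (h34 : s(3, 4) ∉ ω) : (openGraph ω).Reachable 0 4 ↔ s(0, 4) ∈ ω := by
  refine ⟨fun h => ?_, fun h => reachable_openGraph_of_mem ω h (by decide)⟩
  by_contra h04
  exact var978_iso4 ω h04 h14 h24 h34 (y := 0) (by decide) h.symm

/-- `b ↔ a₂` iff the edge `ba₂` is open. [folklore] -/
theorem var978_r13 (ω : BondConfig (Fin 5)) (h03 : s(0, 3) ∉ ω) (h23 : s(2, 3) ∉ ω)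
    (h34 : s(3, 4) ∉ ω) : (openGraph ω).Reachable 1 3 ↔ s(1, 3) ∈ ω := by
  refine ⟨fun h => ?_, fun h => reachable_openGraph_of_mem ω h (by decide)⟩
  by_contra h13
  exact var978_iso3 ω h03 h13 h23 h34 (y := 1) (by decide) h.symm

/-- `o ↔ a₂` iff `ob` and `ba₂` are open. [folklore] -/
theorem var978_r03 (ω : BondConfig (Fin 5)) (h03 : s(0, 3) ∉ ω) (h12 : s(1, 2) ∉ ω)
    (h14 : s(1, 4) ∉ ω) (h23 : s(2, 3) ∉ ω) (h34 : s(3, 4) ∉ ω) :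
    (openGraph ω).Reachable 0 3 ↔ s(0, 1) ∈ ω ∧ s(1, 3) ∈ ω := by
  refine ⟨fun h => ?_, fun h => (reachable_openGraph_of_mem ω h.1 (by decide)).trans
    (reachable_openGraph_of_mem ω h.2 (by decide))⟩
  by_contra hc
  rcases not_and_or.1 hc with h01 | h13
  · exact var978_cut024 ω h01 h03 h12 h23 h14 h34 (Or.inl rfl) (Or.inr rfl) h
  · exact var978_iso3 ω h03 h13 h23 h34 (y := 0) (by decide) h.symm

/-- `b ↔ a₁` iff `ob` and `oa₁` are open. [folklore] -/
theorem var978_r12 (ω : BondConfig (Fin 5)) (h03 : s(0, 3) ∉ ω) (h12 : s(1, 2) ∉ ω)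
    (h14 : s(1, 4) ∉ ω) (h23 : s(2, 3) ∉ ω) (h24 : s(2, 4) ∉ ω) (h34 : s(3, 4) ∉ ω) :
    (openGraph ω).Reachable 1 2 ↔ s(0, 1) ∈ ω ∧ s(0, 2) ∈ ω := by
  refine ⟨fun h => ?_, fun h => ?_⟩
  · by_contra hc
    rcases not_and_or.1 hc with h01 | h02
    · exact var978_cut024 ω h01 h03 h12 h23 h14 h34 (Or.inr (Or.inl rfl)) (Or.inl rfl) h.symm
    · exact var978_iso2 ω h02 h12 h23 h24 (y := 1) (by decide) h.symm
  · have h10 : s(1, 0) ∈ ω := by rw [Sym2.eq_swap]; exact h.1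
    exact (reachable_openGraph_of_mem ω h10 (by decide)).trans
      (reachable_openGraph_of_mem ω h.2 (by decide))

/-- `b ↔ a₃` iff `ob` and `oa₃` are open. [folklore] -/
theorem var978_r14 (ω : BondConfig (Fin 5)) (h03 : s(0, 3) ∉ ω) (h12 : s(1, 2) ∉ ω)
    (h14 : s(1, 4) ∉ ω) (h23 : s(2, 3) ∉ ω) (h24 : s(2, 4) ∉ ω) (h34 : s(3, 4) ∉ ω) :
    (openGraph ω).Reachable 1 4 ↔ s(0, 1) ∈ ω ∧ s(0, 4) ∈ ω := by
  refine ⟨fun h => ?_, fun h => ?_⟩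
  · by_contra hc
    rcases not_and_or.1 hc with h01 | h04
    · exact var978_cut024 ω h01 h03 h12 h23 h14 h34 (Or.inr (Or.inr rfl)) (Or.inl rfl) h.symm
    · exact var978_iso4 ω h04 h14 h24 h34 (y := 1) (by decide) h.symm
  · have h10 : s(1, 0) ∈ ω := by rw [Sym2.eq_swap]; exact h.1
    exact (reachable_openGraph_of_mem ω h10 (by decide)).trans
      (reachable_openGraph_of_mem ω h.2 (by decide))

/-- `a₁ ↔ a₃` iff `oa₁` and `oa₃` are open. [folklore] -/
theorem var978_r24 (ω : BondConfig (Fin 5)) (h12 : s(1, 2) ∉ ω) (h14 : s(1, 4) ∉ ω)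
    (h23 : s(2, 3) ∉ ω) (h24 : s(2, 4) ∉ ω) (h34 : s(3, 4) ∉ ω) :
    (openGraph ω).Reachable 2 4 ↔ s(0, 2) ∈ ω ∧ s(0, 4) ∈ ω := by
  refine ⟨fun h => ?_, fun h => ?_⟩
  · by_contra hc
    rcases not_and_or.1 hc with h02 | h04
    · exact var978_iso2 ω h02 h12 h23 h24 (y := 4) (by decide) h
    · exact var978_iso4 ω h04 h14 h24 h34 (y := 2) (by decide) h.symm
  · have h20 : s(2, 0) ∈ ω := by rw [Sym2.eq_swap]; exact h.1
    exact (reachable_openGraph_of_mem ω h20 (by decide)).trans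
      (reachable_openGraph_of_mem ω h.2 (by decide))

/-- `a₁ ↔ a₂` iff `oa₁`, `ob` and `ba₂` are open. [folklore] -/
theorem var978_r23 (ω : BondConfig (Fin 5)) (h03 : s(0, 3) ∉ ω) (h12 : s(1, 2) ∉ ω)
    (h14 : s(1, 4) ∉ ω) (h23 : s(2, 3) ∉ ω) (h24 : s(2, 4) ∉ ω) (h34 : s(3, 4) ∉ ω) :
    (openGraph ω).Reachable 2 3 ↔ s(0, 2) ∈ ω ∧ s(0, 1) ∈ ω ∧ s(1, 3) ∈ ω := by
  refine ⟨fun h => ?_, fun h => ?_⟩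
  · by_contra hc
    rcases not_and_or.1 hc with h02 | hc'
    · exact var978_iso2 ω h02 h12 h23 h24 (y := 3) (by decide) h
    · rcases not_and_or.1 hc' with h01 | h13
      · exact var978_cut024 ω h01 h03 h12 h23 h14 h34 (Or.inr (Or.inl rfl)) (Or.inr rfl) h
      · exact var978_iso3 ω h03 h13 h23 h34 (y := 2) (by decide) h.symm
  · have h20 : s(2, 0) ∈ ω := by rw [Sym2.eq_swap]; exact h.1
    exact ((reachable_openGraph_of_mem ω h20 (by decide)).trans
      (reachable_openGraph_of_mem ω h.2.1 (by decide))).trans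
      (reachable_openGraph_of_mem ω h.2.2 (by decide))

/-- `a₂ ↔ a₃` iff `ba₂`, `ob` and `oa₃` are open. [folklore] -/
theorem var978_r34 (ω : BondConfig (Fin 5)) (h03 : s(0, 3) ∉ ω) (h12 : s(1, 2) ∉ ω)
    (h14 : s(1, 4) ∉ ω) (h23 : s(2, 3) ∉ ω) (h24 : s(2, 4) ∉ ω) (h34 : s(3, 4) ∉ ω) :
    (openGraph ω).Reachable 3 4 ↔ s(1, 3) ∈ ω ∧ s(0, 1) ∈ ω ∧ s(0, 4) ∈ ω := by
  refine ⟨fun h => ?_, fun h => ?_⟩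
  · by_contra hc
    rcases not_and_or.1 hc with h13 | hc'
    · exact var978_iso3 ω h03 h13 h23 h34 (y := 4) (by decide) h
    · rcases not_and_or.1 hc' with h01 | h04
      · exact var978_cut024 ω h01 h03 h12 h23 h14 h34 (Or.inr (Or.inr rfl)) (Or.inr rfl) h.symm
      · exact var978_iso4 ω h04 h14 h24 h34 (y := 3) (by decide) h.symm
  · have h31 : s(3, 1) ∈ ω := by rw [Sym2.eq_swap]; exact h.1
    have h10 : s(1, 0) ∈ ω := by rw [Sym2.eq_swap]; exact h.2.1
    exact ((reachable_openGraph_of_mem ω h31 (by decide)).trans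
      (reachable_openGraph_of_mem ω h10 (by decide))).trans
      (reachable_openGraph_of_mem ω h.2.2 (by decide))

/-- The six uncharged edges are closed on a configuration carrying only charged edges. -/
theorem var978_closed (ω : BondConfig (Fin 5))
    (hω : ∀ e : Sym2 (Fin 5), e ≠ s(0, 2) → e ≠ s(0, 4) → e ≠ s(0, 1) → e ≠ s(1, 3) → e ∉ ω) :
    s(0, 3) ∉ ω ∧ s(1, 2) ∉ ω ∧ s(1, 4) ∉ ω ∧ s(2, 3) ∉ ω ∧ s(2, 4) ∉ ω ∧ s(3, 4) ∉ ω :=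
  ⟨hω _ (by decide) (by decide) (by decide) (by decide),
    hω _ (by decide) (by decide) (by decide) (by decide),
    hω _ (by decide) (by decide) (by decide) (by decide),
    hω _ (by decide) (by decide) (by decide) (by decide),
    hω _ (by decide) (by decide) (by decide) (by decide),
    hω _ (by decide) (by decide) (by decide) (by decide)⟩

/-! ### The counterexample -/

/-- **The `n = 5` specialisation (TTRL variant V978) of the "Lemma-2-gap" inequality is false.**
Counterexample: the charged tree `a₁ — o — a₃`, `o — b — a₂` on `Fin 5`
(`o = 0, b = 1, a₁ = 2, a₂ = 3, a₃ = 4`) with `w(oa₁) = w(oa₃) = 255/256`, `w(ob) = 1/3`,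
`w(ba₂) = 85/256`, all other weights `0`, and `t = 171/256`: all hypotheses hold
(`τᵢ = 85/256`, pattern gaps `= 7310/2²⁴ > 0`) but the left side (`≈ 1.234e-9`) exceeds the
right side (`≈ 6.549e-10`). [this project] -/
theorem additiveGluing_var978_false : ¬ (∀ (w : Sym2 (Fin 5) → unitInterval) (o b a₁ a₂ a₃ : Fin 5) (t : ℝ), a₁ ≠ a₂ → a₁ ≠ a₃ → a₂ ≠ a₃ → b ≠ a₁ → b ≠ a₂ → b ≠ a₃ → 0 < t → t < 1 → (prodBernoulli w).real (openConn a₁ b) = 1 - t → (prodBernoulli w).real (openConn a₂ b) = 1 - t → (prodBernoulli w).real (openConn a₃ b) = 1 - t → (prodBernoulli w).real (openConn b a₁ ∩ openConn b a₂ ∩ (openConn b a₃)ᶜ) < (prodBernoulli w).real (openConn b a₃ ∩ (openConn b a₁)ᶜ ∩ (openConn b a₂)ᶜ) → (prodBernoulli w).real (openConn b a₂ ∩ openConn b a₃ ∩ (openConn b a₁)ᶜ) < (prodBernoulli w).real (openConn b a₁ ∩ (openConn b a₂)ᶜ ∩ (openConn b a₃)ᶜ) → (prodBernoulli w).real (openConn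 b a₁ ∩ openConn b a₃ ∩ (openConn b a₂)ᶜ) < (prodBernoulli w).real (openConn b a₂ ∩ (openConn b a₁)ᶜ ∩ (openConn b a₃)ᶜ) → (prodBernoulli w).real ((openConn a₁ a₂)ᶜ ∩ (openConn a₁ a₃)ᶜ) * (prodBernoulli w).real ((openConn a₂ a₁)ᶜ ∩ (openConn a₂ a₃)ᶜ) * (prodBernoulli w).real ((openConn a₁ a₃)ᶜ ∩ (openConn a₂ a₃)ᶜ ∩ (openConn a₁ o ∪ openConn a₂ o)) * ((prodBernoulli w).real (openConn b a₃ ∩ (openConn b a₁)ᶜ ∩ (openConn b a₂)ᶜ) - (prodBernoulli w).real (openConn b a₁ ∩ openConn b a₂ ∩ (openConn b a₃)ᶜ)) - (prodBernoulli w).real ((openConn a₁ a₃)ᶜ ∩ (openConn a₂ a₃)ᶜ) * (prodBernoulli w).real ((openConn a₂ a₁)ᶜ ∩ (openConn a₂ a₃)ᶜ) * (prodBernoulli w).real ((openConn a₁ a₂)ᶜ ∩ (openConn a₁ a₃)ᶜ ∩ openConn a₁ o) * ((prodBernoulli w).real (openConn b a₁ ∩ (openConn b a₂)ᶜ ∩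 (openConn b a₃)ᶜ) - (prodBernoulli w).real (openConn b a₂ ∩ openConn b a₃ ∩ (openConn b a₁)ᶜ)) - (prodBernoulli w).real ((openConn a₁ a₃)ᶜ ∩ (openConn a₂ a₃)ᶜ) * (prodBernoulli w).real ((openConn a₁ a₂)ᶜ ∩ (openConn a₁ a₃)ᶜ) * (prodBernoulli w).real ((openConn a₂ a₁)ᶜ ∩ (openConn a₂ a₃)ᶜ ∩ openConn a₂ o) * ((prodBernoulli w).real (openConn b a₂ ∩ (openConn b a₁)ᶜ ∩ (openConn b a₃)ᶜ) - (prodBernoulli w).real (openConn b a₁ ∩ openConn b a₃ ∩ (openConn b a₂)ᶜ)) ≤ (prodBernoulli w).real ((openConn a₁ a₃)ᶜ ∩ (openConn a₂ a₃)ᶜ) * (prodBernoulli w).real ((openConn a₁ a₂)ᶜ ∩ (openConn a₁ a₃)ᶜ) * (prodBernoulli w).real ((openConn a₂ a₁)ᶜ ∩ (openConn a₂ a₃)ᶜ) * (prodBernoulli w).real ((openConn o a₁)ᶜ ∩ (openConn o a₂)ᶜ ∩ (openConn o a₃)ᶜ ∩ (openConn a₃ b)ᶜ)) := by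
  intro h
  have d12 : (s(0, 2) : Sym2 (Fin 5)) ≠ s(0, 4) := by decide
  have d13 : (s(0, 2) : Sym2 (Fin 5)) ≠ s(0, 1) := by decide
  have d14 : (s(0, 2) : Sym2 (Fin 5)) ≠ s(1, 3) := by decide
  have d23 : (s(0, 4) : Sym2 (Fin 5)) ≠ s(0, 1) := by decide
  have d24 : (s(0, 4) : Sym2 (Fin 5)) ≠ s(1, 3) := by decide
  have d34 : (s(0, 1) : Sym2 (Fin 5)) ≠ s(1, 3) := by decide
  -- the charged tree
  set w : Sym2 (Fin 5) → unitInterval := fun e =>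
    if e = s(0, 2) ∨ e = s(0, 4) then ⟨255 / 256, by norm_num, by norm_num⟩
      else if e = s(0, 1) then ⟨1 / 3, by norm_num, by norm_num⟩
      else if e = s(1, 3) then ⟨85 / 256, by norm_num, by norm_num⟩ else 0 with hw
  have w02 : (w s(0, 2) : ℝ) = 255 / 256 := by simp [hw]
  have w04 : (w s(0, 4) : ℝ) = 255 / 256 := by simp [hw]
  have w01 : (w s(0, 1) : ℝ) = 1 / 3 := by simp [hw, d13.symm, d23.symm]
  have w13 : (w s(1, 3) : ℝ) = 85 / 256 := by simp [hw, d14.symm, d24.symm, d34.symm]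
  have hw0 : ∀ e : Sym2 (Fin 5), e ≠ s(0, 2) → e ≠ s(0, 4) → e ≠ s(0, 1) → e ≠ s(1, 3) →
      (w e : ℝ) = 0 := by
    intro e h1 h2 h3 h4
    simp [hw, h1, h2, h3, h4]
  -- exact evaluation through the connectivity table of the tree
  have hpat : ∀ (S : Set (BondConfig (Fin 5))) (f : Prop → Prop → Prop → Prop → Prop),
      (∀ ω : BondConfig (Fin 5), ((openGraph ω).Reachable 1 2 ↔ s(0, 1) ∈ ω ∧ s(0, 2) ∈ ω) →
        ((openGraph ω).Reachable 1 3 ↔ s(1, 3) ∈ ω) →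
        ((openGraph ω).Reachable 1 4 ↔ s(0, 1) ∈ ω ∧ s(0, 4) ∈ ω) →
        ((openGraph ω).Reachable 2 3 ↔ s(0, 2) ∈ ω ∧ s(0, 1) ∈ ω ∧ s(1, 3) ∈ ω) →
        ((openGraph ω).Reachable 2 4 ↔ s(0, 2) ∈ ω ∧ s(0, 4) ∈ ω) →
        ((openGraph ω).Reachable 3 4 ↔ s(1, 3) ∈ ω ∧ s(0, 1) ∈ ω ∧ s(0, 4) ∈ ω) →
        ((openGraph ω).Reachable 0 2 ↔ s(0, 2) ∈ ω) →
        ((openGraph ω).Reachable 0 3 ↔ s(0, 1) ∈ ω ∧ s(1, 3) ∈ ω) →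
        ((openGraph ω).Reachable 0 4 ↔ s(0, 4) ∈ ω) →
        ((openGraph ω).Reachable 2 1 ↔ s(0, 1) ∈ ω ∧ s(0, 2) ∈ ω) →
        ((openGraph ω).Reachable 3 1 ↔ s(1, 3) ∈ ω) →
        ((openGraph ω).Reachable 4 1 ↔ s(0, 1) ∈ ω ∧ s(0, 4) ∈ ω) →
        ((openGraph ω).Reachable 3 2 ↔ s(0, 2) ∈ ω ∧ s(0, 1) ∈ ω ∧ s(1, 3) ∈ ω) →
        ((openGraph ω).Reachable 2 0 ↔ s(0, 2) ∈ ω) →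
        ((openGraph ω).Reachable 3 0 ↔ s(0, 1) ∈ ω ∧ s(1, 3) ∈ ω) →
        (ω ∈ S ↔ f (s(0, 2) ∈ ω) (s(0, 4) ∈ ω) (s(0, 1) ∈ ω) (s(1, 3) ∈ ω))) →
      (prodBernoulli w).real S =
        ∑ c₁ : Bool, ∑ c₂ : Bool, ∑ c₃ : Bool, ∑ c₄ : Bool,
          if f (c₁ = true) (c₂ = true) (c₃ = true) (c₄ = true) then
            (if c₁ then (w s(0, 2) : ℝ) else 1 - w s(0, 2)) *
              (if c₂ then (w s(0, 4) : ℝ) else 1 - w s(0, 4)) *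
              (if c₃ then (w s(0, 1) : ℝ) else 1 - w s(0, 1)) *
              (if c₄ then (w s(1, 3) : ℝ) else 1 - w s(1, 3))
          else 0 := by
    intro S f hS
    refine prodBernoulli_real_eq_sum_prop₄ w d12 d13 d14 d23 d24 d34 hw0 S f fun ω hω => ?_
    obtain ⟨h03, h12, h14, h23, h24, h34⟩ := var978_closed ω hω
    have e12 := var978_r12 ω h03 h12 h14 h23 h24 h34
    have e13 := var978_r13 ω h03 h23 h34
    have e14 := var978_r14 ω h03 h12 h14 h23 h24 h34
    have e23 := var978_r23 ω h03 h12 h14 h23 h24 h34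
    have e02 := var978_r02 ω h12 h23 h24
    have e03 := var978_r03 ω h03 h12 h14 h23 h34
    exact hS ω e12 e13 e14 e23 (var978_r24 ω h12 h14 h23 h24 h34)
      (var978_r34 ω h03 h12 h14 h23 h24 h34) e02 e03 (var978_r04 ω h14 h24 h34)
      (by rw [SimpleGraph.reachable_comm]; exact e12) (by rw [SimpleGraph.reachable_comm]; exact e13)
      (by rw [SimpleGraph.reachable_comm]; exact e14) (by rw [SimpleGraph.reachable_comm]; exact e23)
      (by rw [SimpleGraph.reachable_comm]; exact e02) (by rw [SimpleGraph.reachable_comm]; exact e03)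
  have vτ1 := hpat (openConn 2 1) (fun r₁ _ sb _ => sb ∧ r₁) (by
    intro ω _ _ _ _ _ _ _ _ _ e21 _ _ _ _ _
    simp only [mem_openConn_iff_reachable, e21])
  have vτ2 := hpat (openConn 3 1) (fun _ _ _ x => x) (by
    intro ω _ _ _ _ _ _ _ _ _ _ e31 _ _ _ _
    simp only [mem_openConn_iff_reachable, e31])
  have vτ3 := hpat (openConn 4 1) (fun _ r₃ sb _ => sb ∧ r₃) (by
    intro ω _ _ _ _ _ _ _ _ _ _ _ e41 _ _ _
    simp only [mem_openConn_iff_reachable, e41])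
  have vS3 := hpat (openConn 1 4 ∩ (openConn 1 2)ᶜ ∩ (openConn 1 3)ᶜ)
    (fun r₁ r₃ sb x => ((sb ∧ r₃) ∧ ¬(sb ∧ r₁)) ∧ ¬x) (by
    intro ω e12 e13 e14 _ _ _ _ _ _ _ _ _ _ _ _
    simp only [Set.mem_inter_iff, Set.mem_compl_iff, mem_openConn_iff_reachable, e12, e13, e14])
  have vT3 := hpat (openConn 1 2 ∩ openConn 1 3 ∩ (openConn 1 4)ᶜ)
    (fun r₁ r₃ sb x => ((sb ∧ r₁) ∧ x) ∧ ¬(sb ∧ r₃)) (by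
    intro ω e12 e13 e14 _ _ _ _ _ _ _ _ _ _ _ _
    simp only [Set.mem_inter_iff, Set.mem_compl_iff, mem_openConn_iff_reachable, e12, e13, e14])
  have vT1 := hpat (openConn 1 3 ∩ openConn 1 4 ∩ (openConn 1 2)ᶜ)
    (fun r₁ r₃ sb x => (x ∧ (sb ∧ r₃)) ∧ ¬(sb ∧ r₁)) (by
    intro ω e12 e13 e14 _ _ _ _ _ _ _ _ _ _ _ _
    simp only [Set.mem_inter_iff, Set.mem_compl_iff, mem_openConn_iff_reachable, e12, e13, e14])
  have vS1 := hpat (openConn 1 2 ∩ (openConn 1 3)ᶜ ∩ (openConn 1 4)ᶜ)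
    (fun r₁ r₃ sb x => ((sb ∧ r₁) ∧ ¬x) ∧ ¬(sb ∧ r₃)) (by
    intro ω e12 e13 e14 _ _ _ _ _ _ _ _ _ _ _ _
    simp only [Set.mem_inter_iff, Set.mem_compl_iff, mem_openConn_iff_reachable, e12, e13, e14])
  have vT2 := hpat (openConn 1 2 ∩ openConn 1 4 ∩ (openConn 1 3)ᶜ)
    (fun r₁ r₃ sb x => ((sb ∧ r₁) ∧ (sb ∧ r₃)) ∧ ¬x) (by
    intro ω e12 e13 e14 _ _ _ _ _ _ _ _ _ _ _ _
    simp only [Set.mem_inter_iff, Set.mem_compl_iff, mem_openConn_iff_reachable, e12, e13, e14])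
  have vS2 := hpat (openConn 1 3 ∩ (openConn 1 2)ᶜ ∩ (openConn 1 4)ᶜ)
    (fun r₁ r₃ sb x => (x ∧ ¬(sb ∧ r₁)) ∧ ¬(sb ∧ r₃)) (by
    intro ω e12 e13 e14 _ _ _ _ _ _ _ _ _ _ _ _
    simp only [Set.mem_inter_iff, Set.mem_compl_iff, mem_openConn_iff_reachable, e12, e13, e14])
  have vD1 := hpat ((openConn 2 3)ᶜ ∩ (openConn 2 4)ᶜ)
    (fun r₁ r₃ sb x => ¬(r₁ ∧ sb ∧ x) ∧ ¬(r₁ ∧ r₃)) (by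
    intro ω _ _ _ e23 e24 _ _ _ _ _ _ _ _ _ _
    simp only [Set.mem_inter_iff, Set.mem_compl_iff, mem_openConn_iff_reachable, e23, e24])
  have vD2 := hpat ((openConn 3 2)ᶜ ∩ (openConn 3 4)ᶜ)
    (fun r₁ r₃ sb x => ¬(r₁ ∧ sb ∧ x) ∧ ¬(x ∧ sb ∧ r₃)) (by
    intro ω _ _ _ _ _ e34 _ _ _ _ _ _ e32 _ _
    simp only [Set.mem_inter_iff, Set.mem_compl_iff, mem_openConn_iff_reachable, e32, e34])
  have vD3 := hpat ((openConn 2 4)ᶜ ∩ (openConn 3 4)ᶜ)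
    (fun r₁ r₃ sb x => ¬(r₁ ∧ r₃) ∧ ¬(x ∧ sb ∧ r₃)) (by
    intro ω _ _ _ _ e24 e34 _ _ _ _ _ _ _ _ _
    simp only [Set.mem_inter_iff, Set.mem_compl_iff, mem_openConn_iff_reachable, e24, e34])
  have vE3 := hpat ((openConn 2 4)ᶜ ∩ (openConn 3 4)ᶜ ∩ (openConn 2 0 ∪ openConn 3 0))
    (fun r₁ r₃ sb x => (¬(r₁ ∧ r₃) ∧ ¬(x ∧ sb ∧ r₃)) ∧ (r₁ ∨ (sb ∧ x))) (by
    intro ω _ _ _ _ e24 e34 _ _ _ _ _ _ _ e20 e30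
    simp only [Set.mem_inter_iff, Set.mem_compl_iff, Set.mem_union, mem_openConn_iff_reachable,
      e24, e34, e20, e30])
  have vE1 := hpat ((openConn 2 3)ᶜ ∩ (openConn 2 4)ᶜ ∩ openConn 2 0)
    (fun r₁ r₃ sb x => (¬(r₁ ∧ sb ∧ x) ∧ ¬(r₁ ∧ r₃)) ∧ r₁) (by
    intro ω _ _ _ e23 e24 _ _ _ _ _ _ _ _ e20 _
    simp only [Set.mem_inter_iff, Set.mem_compl_iff, mem_openConn_iff_reachable, e23, e24, e20])
  have vE2 := hpat ((openConn 3 2)ᶜ ∩ (openConn 3 4)ᶜ ∩ openConn 3 0)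
    (fun r₁ r₃ sb x => (¬(r₁ ∧ sb ∧ x) ∧ ¬(x ∧ sb ∧ r₃)) ∧ (sb ∧ x)) (by
    intro ω _ _ _ _ _ e34 _ _ _ _ _ _ e32 _ e30
    simp only [Set.mem_inter_iff, Set.mem_compl_iff, mem_openConn_iff_reachable, e32, e34, e30])
  have vF := hpat ((openConn 0 2)ᶜ ∩ (openConn 0 3)ᶜ ∩ (openConn 0 4)ᶜ ∩ (openConn 4 1)ᶜ)
    (fun r₁ r₃ sb x => ((¬r₁ ∧ ¬(sb ∧ x)) ∧ ¬r₃) ∧ ¬(sb ∧ r₃)) (by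
    intro ω _ _ _ _ _ _ e02 e03 e04 _ _ e41 _ _ _
    simp only [Set.mem_inter_iff, Set.mem_compl_iff, mem_openConn_iff_reachable, e02, e03, e04,
      e41])
  -- the hypotheses of the statement hold ...
  have hτ1 : (prodBernoulli w).real (openConn 2 1) = 1 - 171 / 256 := by
    rw [vτ1]; norm_num [Fintype.sum_bool, w02, w04, w01, w13]
  have hτ2 : (prodBernoulli w).real (openConn 3 1) = 1 - 171 / 256 := by
    rw [vτ2]; norm_num [Fintype.sum_bool, w02, w04, w01, w13]
  have hτ3 : (prodBernoulli w).real (openConn 4 1) = 1 - 171 / 256 := by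
    rw [vτ3]; norm_num [Fintype.sum_bool, w02, w04, w01, w13]
  have hlt3 : (prodBernoulli w).real (openConn 1 2 ∩ openConn 1 3 ∩ (openConn 1 4)ᶜ) <
      (prodBernoulli w).real (openConn 1 4 ∩ (openConn 1 2)ᶜ ∩ (openConn 1 3)ᶜ) := by
    rw [vT3, vS3]; norm_num [Fintype.sum_bool, w02, w04, w01, w13]
  have hlt1 : (prodBernoulli w).real (openConn 1 3 ∩ openConn 1 4 ∩ (openConn 1 2)ᶜ) <
      (prodBernoulli w).real (openConn 1 2 ∩ (openConn 1 3)ᶜ ∩ (openConn 1 4)ᶜ) := by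
    rw [vT1, vS1]; norm_num [Fintype.sum_bool, w02, w04, w01, w13]
  have hlt2 : (prodBernoulli w).real (openConn 1 2 ∩ openConn 1 4 ∩ (openConn 1 3)ᶜ) <
      (prodBernoulli w).real (openConn 1 3 ∩ (openConn 1 2)ᶜ ∩ (openConn 1 4)ᶜ) := by
    rw [vT2, vS2]; norm_num [Fintype.sum_bool, w02, w04, w01, w13]
  -- ... but the conclusion fails
  have key := h w 0 1 2 3 4 (171 / 256) (by decide) (by decide) (by decide) (by decide) (by decide)
    (by decide) (by norm_num) (by norm_num) hτ1 hτ2 hτ3 hlt3 hlt1 hlt2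
  rw [vS3, vT3, vS1, vT1, vS2, vT2, vD1, vD2, vD3, vE3, vE1, vE2, vF] at key
  norm_num [Fintype.sum_bool, w02, w04, w01, w13] at key

end Summit.CriticalPhenomena.PercolationContinuityZ3.Theorems
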